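import Mathlib
import HarnessLib
import Literature.NumberTheory.Automorphic.GaloisActionPlaces
import Literature.NumberTheory.GaloisRepresentations.KummerCharacters
import Literature.NumberTheory.GaloisRepresentations.AbsGaloisOuterConj
import Literature.NumberTheory.Automorphic.ChebotarevArtinRepHolds

/-!
# `TwistUnpackaging` (stmt-Langlands-10903) — Negative knowledge VIII(a): a coherent cubic
# family of rank-one Artin characters which is NOT `τ`-invariant (Kummer character of `∛2`
# over `ℚ(ζ₃)/ℚ`)

Negative knowledge for the crux `Summit.Langlands.Langlands.Theses.QuadraticWindow.TwistUnpackaging`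
and the line `kummer-chebotarev-separating-twists`: the Galois-side object whose existence makes
stub B (`stub_admissiblePowers`) false at rank `0` (see `StubAdmissiblePowersFalse`), and at the
same time the simplest honest instance of the line's lever (a prime-order twist `ψ` with
`ψ(τw) ≠ ψ(w)`).

* `outerConj_smul_kummerRoot` — **Kummer conjugation lemma**: `F/F₀` Galois, `μ_n ⊆ F`, `a ∈ F₀ˣ`,
  `αⁿ = a` in `F̄`; if `σ ∈ Γ_F` acts on `α` through `u ∈ F` then the outer conjugate `θ_t σ`
  (`t ∈ Γ_{F₀}`, `AbsGaloisOuterConj`) acts through `t̄ u`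
  (`t̄ = absGaloisQuot F₀ F t ∈ Gal(F/F₀)`).
* `inflate_kummer_apply_coe` — the rank-one Artin representation `χʲ ∘ r_{F(α)}` (`inflateCharacter`
  of a power of the Kummer character of `KummerCharacters`) has entry `ι(u)ʲ` at such a `σ`.
* `exists_coherentFamily_not_tauInvariant` — over `F = ℚ(ζ₃)` (`CyclotomicField 3 ℚ`, `τ ≠ 1`):
  a finite `Q`, `c : places → μ₃`, `e j = χʲ ∘ r` with arithmetic-Frobenius value `c v ^ j` at every
  `v ∉ Q` (`inflateCharacter_hasFrobCharpolyAt`, `galFrob`), and a place `w₀ ∉ Q ∪ τ⁻¹Q` with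
  `c (τ • w₀) ≠ c w₀`. Proof of the last clause by structure, not by residue-symbol arithmetic:
  otherwise `χ ∘ r` and `(χ ∘ r) ∘ θ_t` share their Frobenius data almost everywhere and coincide
  (`frobenius_dense` + the PROVED `chebotarev_artinRep_holds`), the conjugation lemma with
  `τ ζ₃ = ζ₃²` forces `u² = u` for every `σ`, so `Γ_F` fixes `∛2`, `∛2 ∈ ℚ(ζ₃)`
  (`InfiniteGalois.fixedField_fixingSubgroup`), and norms produce a rational cube equal to `4`
  (`rat_pow_three_ne_four`, `2`-adic valuation).

From the standing disprover's `Disproof.lean` (cdisprove gen 4, cycle 4). [folklore]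
-/

open Literature.NumberTheory.GaloisRepresentations Literature.NumberTheory.Automorphic
open NumberField IsDedekindDomain Field Polynomial IntermediateField Filter MeasureTheory

namespace Summit.Langlands.Langlands.Theorems.TwistUnpackaging.Negative


section KummerConj

variable {F₀ F : Type} [Field F₀] [Field F] [NumberField F] [Algebra F₀ F]

/-- **Kummer conjugation lemma.** `F/F₀` Galois, `μ_n ⊆ F`, `a ∈ F₀ˣ`, `αⁿ = a` in `F̄` (written
through `F`).  If `σ ∈ Γ_F` acts on `α` through `u ∈ F` (`σ α = u α`), then the outer conjugate
`θ_t σ` (`t ∈ Γ_{F₀}`) acts through `t̄ u`: `(θ_t σ) α = (t̄ u) α`,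
`t̄ = absGaloisQuot F₀ F t ∈ Gal(F/F₀)`.
[folklore] -/
theorem outerConj_smul_kummerRoot [IsGalois F₀ F] {n : ℕ} (hn : 0 < n) {ζ : F}
    (hζ : IsPrimitiveRoot ζ n) {a : F₀} (ha : a ≠ 0) {α : AlgebraicClosure F}
    (hα : α ^ n = algebraMap F (AlgebraicClosure F) (algebraMap F₀ F a))
    (t : absoluteGaloisGroup F₀) (σ : absoluteGaloisGroup F) {u : F}
    (hu : σ • α = algebraMap F (AlgebraicClosure F) u * α) :
    absGaloisOuterConj F₀ F t σ • α =
      algebraMap F (AlgebraicClosure F) (absGaloisQuot F₀ F t u) * α := by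
  classical
  haveI : NeZero n := ⟨hn.ne'⟩
  have hinj : Function.Injective (absClosureEmbedding F₀ F) :=
    (absClosureEmbedding_bijective F₀ F).1
  obtain ⟨α₀, rfl⟩ := (absClosureEmbedding_bijective F₀ F).2 α
  have ha' : algebraMap F₀ (AlgebraicClosure F₀) a ≠ 0 :=
    (map_ne_zero_iff _ (algebraMap F₀ (AlgebraicClosure F₀)).injective).2 ha
  -- `α₀ⁿ = a`
  have hα₀ : α₀ ^ n = algebraMap F₀ (AlgebraicClosure F₀) a := by
    apply hinj
    rw [map_pow, hα, AlgHom.commutes, ← IsScalarTower.algebraMap_apply]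
  have hα₀0 : α₀ ≠ 0 := by
    rintro rfl
    rw [zero_pow hn.ne'] at hα₀
    exact ha' hα₀.symm
  -- `res σ • α₀ = e u * α₀`
  have hu₀ : absGaloisRestrict F₀ F σ • α₀ = absEmbedding F₀ F u * α₀ := by
    apply hinj
    rw [absGaloisRestrict_apply_smul, hu, map_mul, absClosureEmbedding_absEmbedding]
  -- the ratio `t⁻¹ α₀ / α₀` is an `n`-th root of unity, i.e. `e (ζ ^ i)`
  have hζ' : IsPrimitiveRoot (absEmbedding F₀ F ζ) n :=
    hζ.map_of_injective (f := (absEmbedding F₀ F : F →+* AlgebraicClosure F₀))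
      (absEmbedding F₀ F : F →+* AlgebraicClosure F₀).injective
  have hfix : ∀ g : absoluteGaloisGroup F₀,
      g • algebraMap F₀ (AlgebraicClosure F₀) a = algebraMap F₀ (AlgebraicClosure F₀) a :=
    fun g => by rw [absoluteGaloisGroup.smul_def, AlgEquiv.commutes]
  obtain ⟨i, -, hi⟩ : ∃ i < n, absEmbedding F₀ F ζ ^ i = (t⁻¹ • α₀) * α₀⁻¹ := by
    apply hζ'.eq_pow_of_pow_eq_one
    rw [mul_pow, ← smul_pow', hα₀, inv_pow, hα₀, hfix, mul_inv_cancel₀ ha']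
  have hν : t⁻¹ • α₀ = absEmbedding F₀ F (ζ ^ i) * α₀ := by
    rw [map_pow, hi, inv_mul_cancel_right₀ hα₀0]
  have hν0 : absEmbedding F₀ F (absGaloisQuot F₀ F t (ζ ^ i)) ≠ 0 :=
    (map_ne_zero_iff _ (absEmbedding F₀ F : F →+* AlgebraicClosure F₀).injective).2
      ((map_ne_zero_iff _ (absGaloisQuot F₀ F t).injective).2
        (pow_ne_zero _ (hζ.ne_zero hn.ne')))
  -- `t • α₀ = (t̄ ζⁱ)⁻¹ α₀`
  have ht : t • α₀ = (absEmbedding F₀ F (absGaloisQuot F₀ F t (ζ ^ i)))⁻¹ * α₀ := by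
    have h1 : t • (t⁻¹ • α₀) = α₀ := smul_inv_smul t α₀
    rw [hν, smul_mul', ← absEmbedding_absGaloisQuot_apply F₀ F t (ζ ^ i)] at h1
    rw [eq_inv_mul_iff_mul_eq₀ hν0, h1]
  -- the computation
  rw [← absGaloisRestrict_apply_smul, absGaloisRestrict_absGaloisOuterConj, mul_smul, mul_smul, hν,
    smul_mul', absGaloisRestrict_smul_absEmbedding F₀ F σ (ζ ^ i), hu₀, smul_mul', smul_mul',
    ← absEmbedding_absGaloisQuot_apply F₀ F t (ζ ^ i), ← absEmbedding_absGaloisQuot_apply F₀ F t u,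
    ht, ← absClosureEmbedding_absEmbedding F₀ F, ← map_mul]
  congr 1
  field_simp

omit [NumberField F] in
/-- **Values of the inflated Kummer character.**  If `σ α = u α` with `u ∈ F`, then the rank-one
Artin representation `χʲ ∘ r_{F(α)}` has matrix entry `ι(u)ʲ` at `σ`. [folklore] -/
theorem inflate_kummer_apply_coe (ι : AlgebraicClosure F →+* ℂ) {α : AlgebraicClosure F}
    (hα0 : α ≠ 0) [FiniteDimensional F F⟮α⟯] [Normal F F⟮α⟯]
    {χ : (F⟮α⟯ ≃ₐ[F] F⟮α⟯) →* ℂˣ}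
    (hχ : ∀ g, ((χ g : ℂˣ) : ℂ) * ι α = ι ((g (AdjoinSimple.gen F α) : F⟮α⟯) : AlgebraicClosure F))
    (j : ℕ) (σ : absoluteGaloisGroup F) {u : F}
    (hu : σ • α = algebraMap F (AlgebraicClosure F) u * α) :
    ((inflateCharacter F⟮α⟯ (χ ^ j) σ : GL (Fin 1) ℂ) : Matrix (Fin 1) (Fin 1) ℂ) 0 0 =
      ι (algebraMap F (AlgebraicClosure F) u) ^ j := by
  rw [inflateCharacter_apply_coe, MonoidHom.pow_apply, Units.val_pow_eq_pow_val]
  congr 1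
  have h := hχ (absRestrictNormalHom F⟮α⟯ σ)
  have hgen : ((absRestrictNormalHom F⟮α⟯ σ (AdjoinSimple.gen F α) : F⟮α⟯) : AlgebraicClosure F) =
      σ • α :=
    AlgEquiv.restrictNormalHom_apply F⟮α⟯ _ _
  rw [hgen, hu, map_mul] at h
  exact mul_right_cancel₀ ((map_ne_zero ι).2 hα0) h

end KummerConj

/-! ### The witness -/

/-- **No rational number has cube `4`** (`2`-adic valuation). [folklore] -/
theorem rat_pow_three_ne_four (r : ℚ) : r ^ 3 ≠ 4 := by
  intro hr
  have hv := congrArg (padicValRat 2) hr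
  rw [padicValRat.pow, show (4 : ℚ) = ((2 ^ 2 : ℕ) : ℚ) by norm_num, padicValRat.of_nat,
    padicValNat.prime_pow] at hv
  omega

/-- **A coherent cubic family which is not `τ`-invariant** (hence
`¬ CoherentFamiliesTauInvariant` of `StubAdmissiblePowersFalse`): `F₀ = ℚ`, `F = ℚ(ζ₃)`
(any third cyclotomic field of `ℚ`; `CyclotomicField 3 ℚ`), `τ` = complex conjugation,
`α = ∛2 ∈ F̄`,
`χ : Gal(F(α)/F) ↪ ℂˣ` the Kummer character, `e j = χʲ ∘ r_{F(α)}`, `c v = χ(Frob_v)`, `Q` = the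
primes ramified in `F(α)`.  If `c (τ • w) = c w` off `Q ∪ τ⁻¹Q`, then `ψ = χ ∘ r` and its outer
conjugate `ψ ∘ θ_t` (`t̄ = τ`) have the same Frobenius data at almost all places, hence coincide
(density of Frobenii, `frobenius_dense` + Chebotarev PROVED in the tree); but `θ_t` turns
`σ α = u α` into `(θ_t σ) α = τ(u) α = u² α` (Kummer conjugation lemma), so `u² = u`, `u = 1`:
every `σ ∈ Γ_F` fixes `α`, `∛2 ∈ ℚ(ζ₃)`, and taking norms `N(∛2)³ = N(2) = 4` in `ℚ` — absurd.
[folklore] -/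
theorem exists_coherentFamily_not_tauInvariant :
    ∃ (F : Type) (_ : Field F) (_ : NumberField F) (_ : Algebra ℚ F) (τ : F ≃ₐ[ℚ] F),
      Module.finrank ℚ F = 2 ∧ τ ≠ 1 ∧
      ∃ (Q : Set (HeightOneSpectrum (𝓞 F))) (c : HeightOneSpectrum (𝓞 F) → ℂ)
        (e : ℕ → FramedGaloisRep F ℂ 1),
        Q.Finite ∧ (∀ v ∉ Q, c v ^ 3 = 1) ∧
        (∀ j : ℕ, ∀ v ∉ Q, (e j).HasFrobCharpolyAt v (X - C (c v ^ j))) ∧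
        ∃ w₀, w₀ ∉ Q ∧ τ • w₀ ∉ Q ∧ c (τ • w₀) ≠ c w₀ := by
  classical
  -- (0) it suffices to treat any third cyclotomic field `K` of `ℚ`; the instance is
  -- `CyclotomicField 3 ℚ` with its splitting-field `ℚ`-algebra structure (the one
  -- `CyclotomicField.isCyclotomicExtension` is stated for; `DivisionRing.toRatAlgebra` is only
  -- propositionally equal to it)
  suffices key : ∀ (K : Type) [Field K] [NumberField K] [Algebra ℚ K]
      [IsCyclotomicExtension {3} ℚ K], ∃ (τ : K ≃ₐ[ℚ] K), Module.finrank ℚ K = 2 ∧ τ ≠ 1 ∧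
      ∃ (Q : Set (HeightOneSpectrum (𝓞 K))) (c : HeightOneSpectrum (𝓞 K) → ℂ)
        (e : ℕ → FramedGaloisRep K ℂ 1),
        Q.Finite ∧ (∀ v ∉ Q, c v ^ 3 = 1) ∧
        (∀ j : ℕ, ∀ v ∉ Q, (e j).HasFrobCharpolyAt v (X - C (c v ^ j))) ∧
        ∃ w₀, w₀ ∉ Q ∧ τ • w₀ ∉ Q ∧ c (τ • w₀) ≠ c w₀ by
    letI hAlg : Algebra ℚ (CyclotomicField 3 ℚ) := CyclotomicField.algebra 3 ℚ
    obtain ⟨τ, h⟩ := key (CyclotomicField 3 ℚ)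
    exact ⟨CyclotomicField 3 ℚ, inferInstance, inferInstance, hAlg, τ, h⟩
  intro K _ _ _ _
  -- (1) the quadratic field `K = ℚ(ζ₃)`
  have h3 : (0 : ℕ) < 3 := by norm_num
  haveI : NeZero (3 : ℕ) := ⟨by norm_num⟩
  obtain ⟨ζ, hζ⟩ : ∃ ζ : K, IsPrimitiveRoot ζ 3 := ⟨_, IsCyclotomicExtension.zeta_spec 3 ℚ K⟩
  have hirr : Irreducible (cyclotomic 3 ℚ) := cyclotomic.irreducible_rat (by norm_num)
  have hdeg : Module.finrank ℚ K = 2 := by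
    rw [IsCyclotomicExtension.finrank K hirr]
    decide
  haveI hG : IsGalois ℚ K := IsCyclotomicExtension.isGalois {3} ℚ K
  -- (2) `τ ≠ 1`, and `τ ζ = ζ²`
  obtain ⟨τ, hτ⟩ : ∃ τ : K ≃ₐ[ℚ] K, τ ≠ 1 := by
    by_contra hall
    push Not at hall
    haveI : Subsingleton (K ≃ₐ[ℚ] K) := ⟨fun a b => (hall a).trans (hall b).symm⟩
    have h1 : Nat.card (K ≃ₐ[ℚ] K) = 1 := Nat.card_of_subsingleton (1 : K ≃ₐ[ℚ] K)
    have h2 : Nat.card (K ≃ₐ[ℚ] K) = Module.finrank ℚ K := IsGalois.card_aut_eq_finrank ℚ K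
    omega
  have hτζ : τ ζ = ζ ^ 2 := by
    obtain ⟨j, hj, hjζ⟩ := hζ.eq_pow_of_pow_eq_one (ξ := τ ζ)
      (by rw [← map_pow, hζ.pow_eq_one, map_one])
    interval_cases j
    · rw [pow_zero] at hjζ
      exact absurd (τ.injective (hjζ.symm.trans (map_one τ).symm)) (hζ.ne_one (by norm_num))
    · rw [pow_one] at hjζ
      exfalso
      apply hτ
      apply AlgEquiv.coe_toAlgHom_injective
      apply (hζ.powerBasis ℚ).algHom_ext
      rw [IsPrimitiveRoot.powerBasis_gen]
      exact hjζ.symm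
    · exact hjζ.symm
  -- (3) the Kummer field of `∛2` and its character
  have h2F : (2 : K) ≠ 0 := two_ne_zero
  obtain ⟨α, hα⟩ : ∃ α : AlgebraicClosure K, α ^ 3 = algebraMap K (AlgebraicClosure K) 2 :=
    IsAlgClosed.exists_pow_nat_eq _ h3
  have hα' : α ^ 3 = algebraMap K (AlgebraicClosure K) (algebraMap ℚ K 2) := by
    rw [map_ofNat]
    exact hα
  have hα0 : α ≠ 0 := KummerCharacter.root_ne_zero h3 h2F hα
  haveI : Algebra.IsAlgebraic ℚ (AlgebraicClosure K) :=
    Algebra.IsAlgebraic.trans ℚ K (AlgebraicClosure K)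
  let ι : AlgebraicClosure K →+* ℂ :=
    (IsAlgClosed.lift (R := ℚ) (M := ℂ) (S := AlgebraicClosure K)).toRingHom
  obtain ⟨χ, hχ⟩ := KummerCharacter.exists_character ι h3 hζ h2F hα
  haveI hfd : FiniteDimensional K K⟮α⟯ := KummerCharacter.finiteDimensional_adjoin h3 hα
  haveI hgal : IsGalois K K⟮α⟯ := KummerCharacter.isGalois_adjoin h3 hζ h2F hα
  haveI : NumberField K⟮α⟯ := NumberField.of_module_finite K _
  haveI hab : IsAbelianGalois K K⟮α⟯ := KummerCharacter.isAbelianGalois ι h3 hζ h2F hα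
  have hcomm : ∀ a b : K⟮α⟯ ≃ₐ[K] K⟮α⟯, Commute a b := commute_of_isAbelianGalois K⟮α⟯
  -- (4) the family `(Q, c, e)`
  let Q : Set (HeightOneSpectrum (𝓞 K)) := {v | ¬ Algebra.IsUnramifiedIn (𝓞 K⟮α⟯) v.asIdeal}
  have hQ : Q.Finite := finite_setOf_not_isUnramifiedIn K K⟮α⟯
  let c : HeightOneSpectrum (𝓞 K) → ℂ := fun v => ((χ (galFrob K K⟮α⟯ v) : ℂˣ) : ℂ)
  let e : ℕ → FramedGaloisRep K ℂ 1 := fun j => inflateCharacter K⟮α⟯ (χ ^ j)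
  have hc : ∀ v ∉ Q, c v ^ 3 = 1 := fun v _ => by
    show ((χ _ : ℂˣ) : ℂ) ^ 3 = 1
    rw [← Units.val_pow_eq_pow_val, KummerCharacter.pow_eq_one ι h3 h2F hα hχ, Units.val_one]
  have he : ∀ j : ℕ, ∀ v ∉ Q, (e j).HasFrobCharpolyAt v (X - C (c v ^ j)) := by
    intro j v hv
    have hunr : Algebra.IsUnramifiedIn (𝓞 K⟮α⟯) v.asIdeal := not_not.1 hv
    have h := inflateCharacter_hasFrobCharpolyAt K⟮α⟯ (χ ^ j) hcomm hunr
    simpa only [MonoidHom.pow_apply, Units.val_pow_eq_pow_val] using h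
  refine ⟨τ, hdeg, hτ, Q, c, e, hQ, hc, he, ?_⟩
  -- (5) suppose the family were `τ`-invariant off `Q`
  by_contra hinv
  push Not at hinv
  -- (6) `ψ = e 1` and its outer conjugate have the same Frobenius data off `S = Q ∪ τ⁻¹ Q`
  obtain ⟨t, ht⟩ := absGaloisQuot_surjective ℚ K τ
  let S : Set (HeightOneSpectrum (𝓞 K)) := Q ∪ (fun w => τ • w) ⁻¹' Q
  have hS : S.Finite := hQ.union (hQ.preimage (MulAction.injective τ).injOn)
  have hψ : ∀ w ∉ Q, (e 1).HasFrobCharpolyAt w (X - C (c w)) := fun w hw => by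
    simpa only [pow_one] using he 1 w hw
  have hψ' : ∀ w ∉ S, ((e 1).outerConj t).HasFrobCharpolyAt w (X - C (c w)) := fun w hw => by
    rw [FramedGaloisRep.hasFrobCharpolyAt_outerConj_iff, ht]
    have h1 : τ • w ∉ Q := fun h => hw (Or.inr h)
    have h2 : w ∉ Q := fun h => hw (Or.inl h)
    rw [← hinv w h2 h1]
    exact hψ (τ • w) h1
  -- (7) density of Frobenii: the two characters agree everywhere
  have hall : ∀ σ : absoluteGaloisGroup K,
      FramedRep.trace ((e 1).outerConj t) σ = FramedRep.trace (e 1) σ := by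
    have hD : {σ : absoluteGaloisGroup K | ∃ v ∉ S, ∃ 𝔓 ∈ v.primesAbove, IsArithFrobAt (𝓞 K) σ 𝔓} ⊆
        {σ | FramedRep.trace ((e 1).outerConj t) σ = FramedRep.trace (e 1) σ} := by
      rintro σ ⟨v, hv, 𝔓, h𝔓, hσ⟩
      have h1 : FramedRep.charpoly ((e 1).outerConj t) σ = X - C (c v) := hψ' v hv 𝔓 h𝔓 σ hσ
      have h2 : FramedRep.charpoly (e 1) σ = X - C (c v) := hψ v (fun h => hv (Or.inl h)) 𝔓 h𝔓 σ hσ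
      show FramedRep.trace ((e 1).outerConj t) σ = FramedRep.trace (e 1) σ
      haveI : Nonempty (Fin 1) := ⟨0⟩
      unfold FramedRep.trace
      rw [Matrix.trace_eq_neg_charpoly_coeff, Matrix.trace_eq_neg_charpoly_coeff]
      change -((FramedRep.charpoly ((e 1).outerConj t) σ).coeff _) =
        -((FramedRep.charpoly (e 1) σ).coeff _)
      rw [h1, h2]
    have hclosed : IsClosed {σ : absoluteGaloisGroup K |
        FramedRep.trace ((e 1).outerConj t) σ = FramedRep.trace (e 1) σ} :=
      isClosed_eq (FramedRep.continuous_trace _) (FramedRep.continuous_trace _)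
    intro σ
    have hmem : σ ∈ closure {σ : absoluteGaloisGroup K |
        ∃ v ∉ S, ∃ 𝔓 ∈ v.primesAbove, IsArithFrobAt (𝓞 K) σ 𝔓} := by
      rw [(absoluteGaloisGroup.frobenius_dense chebotarev_artinRep_holds K S hS).closure_eq]
      exact Set.mem_univ σ
    exact hclosed.closure_subset_iff.2 hD hmem
  have hval : ∀ σ : absoluteGaloisGroup K,
      (((e 1).outerConj t σ : GL (Fin 1) ℂ) : Matrix (Fin 1) (Fin 1) ℂ) 0 0 =
        ((e 1 σ : GL (Fin 1) ℂ) : Matrix (Fin 1) (Fin 1) ℂ) 0 0 := by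
    intro σ
    have h := hall σ
    unfold FramedRep.trace at h
    rwa [Matrix.trace_fin_one, Matrix.trace_fin_one] at h
  -- (8) every `σ ∈ Γ_F` acts on `α` through a cube root of unity of `K3`
  have hζ' : IsPrimitiveRoot (algebraMap K (AlgebraicClosure K) ζ) 3 :=
    hζ.map_of_injective (f := algebraMap K (AlgebraicClosure K))
      (algebraMap K (AlgebraicClosure K)).injective
  have hroot : ∀ σ : absoluteGaloisGroup K, ∃ i < 3,
      σ • α = algebraMap K (AlgebraicClosure K) (ζ ^ i) * α := by
    intro σ
    obtain ⟨i, hi, h⟩ := hζ'.eq_pow_of_pow_eq_one (ξ := (σ • α) * α⁻¹) (by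
      rw [mul_pow, ← smul_pow', hα, inv_pow, hα, absoluteGaloisGroup.smul_def, AlgEquiv.commutes,
        mul_inv_cancel₀]
      exact (map_ne_zero_iff _ (algebraMap K (AlgebraicClosure K)).injective).2 h2F)
    exact ⟨i, hi, by rw [map_pow, h, inv_mul_cancel_right₀ hα0]⟩
  -- (9) `θ_t` squares the root of unity, so it is `1`: `Γ_F` fixes `α`
  have hfixα : ∀ σ : absoluteGaloisGroup K, σ • α = α := by
    intro σ
    obtain ⟨i, -, hi⟩ := hroot σ
    have hθ := outerConj_smul_kummerRoot h3 hζ (two_ne_zero (α := ℚ)) hα' t σ hi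
    rw [ht] at hθ
    have h1 := inflate_kummer_apply_coe ι hα0 hχ 1 σ hi
    have h2 := inflate_kummer_apply_coe ι hα0 hχ 1 (absGaloisOuterConj ℚ K t σ) hθ
    rw [pow_one] at h1 h2
    have h4 : ι (algebraMap K (AlgebraicClosure K) (τ (ζ ^ i))) =
        ι (algebraMap K (AlgebraicClosure K) (ζ ^ i)) := by
      rw [← h1, ← h2]
      exact hval σ
    have h5 : τ (ζ ^ i) = ζ ^ i := (algebraMap K (AlgebraicClosure K)).injective (ι.injective h4)
    rw [map_pow, hτζ, ← pow_mul] at h5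
    have h6 : ζ ^ i = 1 := by
      have h7 : ζ ^ i * ζ ^ i = ζ ^ i * 1 := by rw [mul_one, ← pow_add, ← two_mul, h5]
      exact mul_left_cancel₀ (pow_ne_zero _ (hζ.ne_zero (by norm_num))) h7
    rw [hi, h6, map_one, one_mul]
  -- (10) hence `α ∈ K`: `∛2 ∈ ℚ(ζ₃)`
  have hαK : α ∈ (⊥ : IntermediateField K (AlgebraicClosure K)) := by
    haveI : IsGalois K (AlgebraicClosure K) := {}
    rw [← InfiniteGalois.fixedField_fixingSubgroup (⊥ : IntermediateField K (AlgebraicClosure K)),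
      IntermediateField.fixingSubgroup_bot]
    intro σ
    exact hfixα ((absoluteGaloisGroup.toAlgEquiv K).symm σ.1)
  obtain ⟨β, hβ⟩ := IntermediateField.mem_bot.1 hαK
  -- (11) norms: `N(β)³ = N(2) = 4` in `ℚ`
  have hβ3 : β ^ 3 = 2 := (algebraMap K (AlgebraicClosure K)).injective (by rw [map_pow, hβ, hα])
  have hN := congrArg (Algebra.norm ℚ) hβ3
  rw [map_pow, show (2 : K) = algebraMap ℚ K 2 by norm_num, Algebra.norm_algebraMap, hdeg] at hN
  exact rat_pow_three_ne_four _ (by rw [hN]; norm_num)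


end Summit.Langlands.Langlands.Theorems.TwistUnpackaging.Negative
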